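import Summits.Ventures.CertifiedManyBodySolver.Downfold.StiffnessSeam
import Summits.Ventures.CertifiedManyBodySolver.Downfold.BoxesNdNiO2E
import Summits.Ventures.CertifiedManyBodySolver.Certificates.HubbardSquare_NdM21BoxE_stiffness_kinematic
import Summits.Ventures.CertifiedManyBodySolver.Certificates.HubbardSquare_NdHgBoxE_stiffness_kinematic
import Summits.Ventures.CertifiedManyBodySolver.Certificates.HubbardSquare_NdSr025BoxE_stiffness_kinematic
import Summits.Ventures.CertifiedManyBodySolver.Certificates.HubbardSquare_NiClBoxE_stiffness_kinematic
import HarnessLib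

/-!
# Kinematic STIFFNESS words (ground-state, thermal, KT reading) typed on the d⁹-NICKELATE object-E boxes of record
# `boxNdNiO2E_M21` (NdNiO₂ parent), `boxNdSrNiO2E_M22` (x = 0.2), `boxNdSrNiO2E_M59` (x = 0.10), `boxNdSrNiO2E_M60` (x = 0.25)

Venture CertifiedManyBodySolver, cells `pub/hubbard-downfold` (MO-S1 ↔ S3 seam; D-0150 L-DF2 «box ↦ one word») and `pub/hubbard-obs`
(D-0154 (1)(C) COVERAGE, NdNiO₂), seat `hubbard-cov-ndnio2-box-2` (`prover-hubbard-cov-ndnio2-box-2-0`); the nickelate companion of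
`Downfold/BoxesCuprateEStiffnessKinematic.lean` (whose header note «nickelate boxes not typed — t′ outside today's kernel leaf range» predates
the four kernel leaves cited here). It discharges BY CITATION the support item S0 of hubbard-obs RULING (mmm) d309 («κ₂₁ = the nickelate kinematic
stiffness word»): **κ₂₁ = 0.4877121** on `boxNdNiO2E_M21`, so the PEN's D-0150 content bar for the rung leaf «MOS2-ndnio2-M21» reads
`0.98 × 0.4877121 ↦ 0.4779578` (rounded down at the 7th decimal; typed in `Observables/RungLeavesCoverage.lean` §4).

HONEST FRAMING: node-free one-body (kinematic) CEILINGS — every number is a kernel theorem of hubbard-tc p1's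
`Certificates/HubbardSquare_{NdM21,NiCl,NdHg,NdSr025}BoxE_stiffness_kinematic.lean` (four-corner majorant, `M = 128` pair table,
`Literature/…/HalfBathtubPairTableRows{NdM21,NiCl,Nd,NdSr025}.lean`; first-order corner slack `≈ +0.005…+0.007` above the cell's engine
previews, which stay the float numbers of record); a ceiling never speaks to the presence of order; the KT reading `T_c ≤ (π/4)·c` is
CONDITIONAL on the monotonicity-free dictionary `ThermalKTDictionaryAt` at the point (2D single-layer MODEL per NiO₂ plane, not a material
`T_c`); a downfolded box is a systematic modelling claim (words of record «1BH+3BE», router/BOXES/NdNiO2.md, BOX #20); never «certified true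
negative / positive»; no phase sentence. `U/t` is idle in every word (kinematics).

| box | delivered cell (t′/t, n) | leaf (cell it is read on) | `c` | `T_c ≤` (KT, tree units) |
|---|---|---|---|---|
| `boxNdNiO2E_M21` | [−0.46, −0.36] × [0.852, 0.954] | `ndBoxE_parentM21col` ([−23/50, −9/25], n ≤ 477/500) | 0.4877121 | 0.3830482 |
| `boxNdSrNiO2E_M22` | [−0.46, −0.36] × [0.718, 0.818] | `psnoBoxE12_x02` ([−23/50, −7/20] ⊇, n ≤ 409/500) | 0.4509038 | 0.3541391 |
| `boxNdSrNiO2E_M59` | [−0.46, −0.36] × [0.79, 0.89] | `ndBoxE_parent` ([−23/50, −9/25], n ≤ 9/10) | 0.4736879 | 0.3720337 |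
| `boxNdSrNiO2E_M60` | [−0.46, −0.36] × [0.686, 0.786] | `ndBoxE_sr025` ([−23/50, −9/25], n ≤ 393/500) | 0.4414575 | 0.3467200 |

(M22: the same-hull leaf `ndBoxE_sr02` (n ≤ 21/25) gives the weaker `0.4572025`; the `t′`-superset leaf `psnoBoxE12_x02` is read at the column's exact
top filling `409/500` and is the tighter kernel constant — a kinematic cell bound is material-agnostic.) Binding corner of every word: the
large-`|t′|` × top-filling corner `(t′, n) = (−0.46, n_max)` (engine preview `0.4809983` on M21).

References: T. Hazra, N. Verma, M. Randeria, PRX 9 (2019) 031049, eqs. (2)–(6) [HazraVermaRanderia2019]; A. Paramekanti, N. Trivedi,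
M. Randeria, PRB 57 (1998) 11639, eq. (3), §IV [ParamekantiTrivediRanderia1998].
-/

noncomputable section

namespace Summit.Ventures.CertifiedManyBodySolver.Downfold

open Set NonemptyInterval
open Summit.Ventures.CertifiedManyBodySolver.Observables
open Summit.Ventures.CertifiedManyBodySolver.Certificates

/-- Coordinates of a point of a delivered box `Set.Icc ![a, b, c] ![a', b', c']` (order `(U/t, t′/t, n)`). [folklore] -/
private theorem mem_s2Box_vec3N {a b c a' b' c' : ℝ} {θ : Fin 3 → ℝ}
    (hθ : θ ∈ Set.Icc (![a, b, c] : Fin 3 → ℝ) ![a', b', c']) :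
    (a ≤ θ 0 ∧ θ 0 ≤ a') ∧ (b ≤ θ 1 ∧ θ 1 ≤ b') ∧ (c ≤ θ 2 ∧ θ 2 ≤ c') := by
  rw [Set.mem_Icc, Pi.le_def, Pi.le_def] at hθ
  obtain ⟨hlo, hhi⟩ := hθ
  have h0 := hlo 0; have h1 := hlo 1; have h2 := hlo 2
  have h0' := hhi 0; have h1' := hhi 1; have h2' := hhi 2
  simp only [Matrix.cons_val_zero, Matrix.cons_val_one, Matrix.head_cons, Matrix.cons_val_two,
    Matrix.tail_cons] at h0 h1 h2 h0' h1' h2'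
  exact ⟨⟨h0, h0'⟩, ⟨h1, h1'⟩, ⟨h2, h2'⟩⟩

/-! ### `boxNdNiO2E_M21` — NdNiO₂ parent film (VSET #21, object E: U/t ∈ [5, 8.5], t′ ∈ [−0.46, −0.36], n ∈ [0.852, 0.954]) -/

/-- **Kinematic ground-state stiffness word on `boxNdNiO2E_M21` — the d309 «κ₂₁»** (node-free): `ρ_s ≤ 4877121/10000000` at every point of the box
(hubbard-tc p1's `ndBoxE_parentM21col_stiffnessSeqLeaf`, read on the column's exact `(t′, n)` face). [cite: HazraVermaRanderia2019, eqs. (2)-(6)] -/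
theorem boxNdNiO2E_M21_stiffness_kinematic :
    HoldsOn (fun p : OneBandCoord → ℝ =>
      ObsStiffnessSeqCeilingAt (p .tpOverT) (p .UOverT) (p .filling) (4877121 / 10000000)) boxNdNiO2E_M21 := by
  refine holdsOn_of_forall_s2Box (B := boxNdNiO2E_M21) (eU := ndNiO2E_M21_U) (eS := ndNiO2E_M21_tp) (eN := ndNiO2E_M21_n) rfl rfl rfl
    (W := fun θ => ObsStiffnessSeqCeilingAt (θ 1) (θ 0) (θ 2) (4877121 / 10000000)) ?_
  rw [ndNiO2E_M21_s2Lo, ndNiO2E_M21_s2Hi]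
  intro θ hθ
  obtain ⟨-, htθ, hnθ⟩ := mem_s2Box_vec3N hθ
  exact ndBoxE_parentM21col_stiffnessSeqLeaf htθ (by linarith [hnθ.1]) (by linarith [hnθ.2])

/-- **Kinematic thermal stiffness word on `boxNdNiO2E_M21`** (every temperature): `ObsThermalStiffnessSeqCeilingAt … 4877121/10000000` at every point.
[cite: ParamekantiTrivediRanderia1998, eq. (3) and §IV] -/
theorem boxNdNiO2E_M21_thermalStiffness_kinematic :
    HoldsOn (fun p : OneBandCoord → ℝ =>
      ObsThermalStiffnessSeqCeilingAt (p .tpOverT) (p .UOverT) (p .filling) (4877121 / 10000000)) boxNdNiO2E_M21 := by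
  refine holdsOn_of_forall_s2Box (B := boxNdNiO2E_M21) (eU := ndNiO2E_M21_U) (eS := ndNiO2E_M21_tp) (eN := ndNiO2E_M21_n) rfl rfl rfl
    (W := fun θ => ObsThermalStiffnessSeqCeilingAt (θ 1) (θ 0) (θ 2) (4877121 / 10000000)) ?_
  rw [ndNiO2E_M21_s2Lo, ndNiO2E_M21_s2Hi]
  intro θ hθ
  obtain ⟨-, htθ, hnθ⟩ := mem_s2Box_vec3N hθ
  exact ndBoxE_parentM21col_thermalStiffnessSeqLeaf htθ (by linarith [hnθ.1]) (by linarith [hnθ.2])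

/-- **KT reading on `boxNdNiO2E_M21`** (CONDITIONAL on `ThermalKTDictionaryAt` at the point, per NiO₂ plane): `T_c ≤ 0.3830482` (tree units `t = 1`).
[cite: HazraVermaRanderia2019, eqs. (2)-(3) and App. G] -/
theorem boxNdNiO2E_M21_Tc_le_kinematic_KT :
    HoldsOn (fun p : OneBandCoord → ℝ => ∀ (ρe : ℝ → ℝ) (Tc : ℝ),
      ThermalKTDictionaryAt (p .tpOverT) (p .UOverT) (p .filling) ρe Tc → Tc ≤ 0.3830482) boxNdNiO2E_M21 := by
  refine holdsOn_of_forall_s2Box (B := boxNdNiO2E_M21) (eU := ndNiO2E_M21_U) (eS := ndNiO2E_M21_tp) (eN := ndNiO2E_M21_n) rfl rfl rfl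
    (W := fun θ => ∀ (ρe : ℝ → ℝ) (Tc : ℝ), ThermalKTDictionaryAt (θ 1) (θ 0) (θ 2) ρe Tc → Tc ≤ 0.3830482) ?_
  rw [ndNiO2E_M21_s2Lo, ndNiO2E_M21_s2Hi]
  intro θ hθ ρe Tc hKT
  obtain ⟨-, htθ, hnθ⟩ := mem_s2Box_vec3N hθ
  exact Summit.Ventures.CertifiedManyBodySolver.Certificates.ThermalKTDictionaryAt.ndBoxE_parentM21col_le_decimal htθ
    (by linarith [hnθ.1]) (by linarith [hnθ.2]) hKT

/-! ### `boxNdSrNiO2E_M22` — Nd₀.₈Sr₀.₂NiO₂ (VSET #22, the superconducting film composition; object E: t′ ∈ [−0.46, −0.36], n ∈ [0.718, 0.818]) -/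

/-- **Kinematic ground-state stiffness word on `boxNdSrNiO2E_M22`** (node-free): `ρ_s ≤ 4509038/10000000` at every point of the box (hubbard-tc p1's
`psnoBoxE12_x02_stiffnessSeqLeaf`, a kernel leaf on the `t′`-SUPERSET cell `[−23/50, −7/20]` at the column's exact top filling `409/500`; the same-hull leaf
`ndBoxE_sr02_stiffnessSeqLeaf` (`n ≤ 21/25`) gives the weaker `0.4572025`). [cite: HazraVermaRanderia2019, eqs. (2)-(6)] -/
theorem boxNdSrNiO2E_M22_stiffness_kinematic :
    HoldsOn (fun p : OneBandCoord → ℝ =>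
      ObsStiffnessSeqCeilingAt (p .tpOverT) (p .UOverT) (p .filling) (4509038 / 10000000)) boxNdSrNiO2E_M22 := by
  refine holdsOn_of_forall_s2Box (B := boxNdSrNiO2E_M22) (eU := ndSrNiO2E_M22_U) (eS := ndSrNiO2E_M22_tp) (eN := ndSrNiO2E_M22_n) rfl rfl rfl
    (W := fun θ => ObsStiffnessSeqCeilingAt (θ 1) (θ 0) (θ 2) (4509038 / 10000000)) ?_
  rw [ndSrNiO2E_M22_s2Lo, ndSrNiO2E_M22_s2Hi]
  intro θ hθ
  obtain ⟨-, htθ, hnθ⟩ := mem_s2Box_vec3N hθ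
  exact psnoBoxE12_x02_stiffnessSeqLeaf ⟨htθ.1, htθ.2.trans (by norm_num)⟩ (by linarith [hnθ.1]) (by linarith [hnθ.2])

/-- **Kinematic thermal stiffness word on `boxNdSrNiO2E_M22`** (every temperature): `ObsThermalStiffnessSeqCeilingAt … 4509038/10000000` at every point.
[cite: ParamekantiTrivediRanderia1998, eq. (3) and §IV] -/
theorem boxNdSrNiO2E_M22_thermalStiffness_kinematic :
    HoldsOn (fun p : OneBandCoord → ℝ =>
      ObsThermalStiffnessSeqCeilingAt (p .tpOverT) (p .UOverT) (p .filling) (4509038 / 10000000)) boxNdSrNiO2E_M22 := by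
  refine holdsOn_of_forall_s2Box (B := boxNdSrNiO2E_M22) (eU := ndSrNiO2E_M22_U) (eS := ndSrNiO2E_M22_tp) (eN := ndSrNiO2E_M22_n) rfl rfl rfl
    (W := fun θ => ObsThermalStiffnessSeqCeilingAt (θ 1) (θ 0) (θ 2) (4509038 / 10000000)) ?_
  rw [ndSrNiO2E_M22_s2Lo, ndSrNiO2E_M22_s2Hi]
  intro θ hθ
  obtain ⟨-, htθ, hnθ⟩ := mem_s2Box_vec3N hθ
  exact psnoBoxE12_x02_thermalStiffnessSeqLeaf ⟨htθ.1, htθ.2.trans (by norm_num)⟩ (by linarith [hnθ.1]) (by linarith [hnθ.2])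

/-- **KT reading on `boxNdSrNiO2E_M22`** (CONDITIONAL on `ThermalKTDictionaryAt` at the point, per NiO₂ plane): `T_c ≤ 0.3541391` (tree units `t = 1`).
[cite: HazraVermaRanderia2019, eqs. (2)-(3) and App. G] -/
theorem boxNdSrNiO2E_M22_Tc_le_kinematic_KT :
    HoldsOn (fun p : OneBandCoord → ℝ => ∀ (ρe : ℝ → ℝ) (Tc : ℝ),
      ThermalKTDictionaryAt (p .tpOverT) (p .UOverT) (p .filling) ρe Tc → Tc ≤ 0.3541391) boxNdSrNiO2E_M22 := by
  refine holdsOn_of_forall_s2Box (B := boxNdSrNiO2E_M22) (eU := ndSrNiO2E_M22_U) (eS := ndSrNiO2E_M22_tp) (eN := ndSrNiO2E_M22_n) rfl rfl rfl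
    (W := fun θ => ∀ (ρe : ℝ → ℝ) (Tc : ℝ), ThermalKTDictionaryAt (θ 1) (θ 0) (θ 2) ρe Tc → Tc ≤ 0.3541391) ?_
  rw [ndSrNiO2E_M22_s2Lo, ndSrNiO2E_M22_s2Hi]
  intro θ hθ ρe Tc hKT
  obtain ⟨-, htθ, hnθ⟩ := mem_s2Box_vec3N hθ
  exact Summit.Ventures.CertifiedManyBodySolver.Certificates.ThermalKTDictionaryAt.psnoBoxE12_x02_le_decimal
    ⟨htθ.1, htθ.2.trans (by norm_num)⟩ (by linarith [hnθ.1]) (by linarith [hnθ.2]) hKT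

/-! ### `boxNdSrNiO2E_M59` — Nd₀.₉Sr₀.₁NiO₂ (VSET-v2 #59, object E: t′ ∈ [−0.46, −0.36], n ∈ [0.79, 0.89]) -/

/-- **Kinematic ground-state stiffness word on `boxNdSrNiO2E_M59`** (node-free): `ρ_s ≤ 4736879/10000000` at every point of the box (hubbard-tc p1's
`ndBoxE_parent_stiffnessSeqLeaf`, the same `t′` hull read at `n ≤ 9/10 ≥ 0.89`). [cite: HazraVermaRanderia2019, eqs. (2)-(6)] -/
theorem boxNdSrNiO2E_M59_stiffness_kinematic :
    HoldsOn (fun p : OneBandCoord → ℝ =>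
      ObsStiffnessSeqCeilingAt (p .tpOverT) (p .UOverT) (p .filling) (4736879 / 10000000)) boxNdSrNiO2E_M59 := by
  refine holdsOn_of_forall_s2Box (B := boxNdSrNiO2E_M59) (eU := ndSrNiO2E_M59_U) (eS := ndSrNiO2E_M59_tp) (eN := ndSrNiO2E_M59_n) rfl rfl rfl
    (W := fun θ => ObsStiffnessSeqCeilingAt (θ 1) (θ 0) (θ 2) (4736879 / 10000000)) ?_
  rw [ndSrNiO2E_M59_s2Lo, ndSrNiO2E_M59_s2Hi]
  intro θ hθ
  obtain ⟨-, htθ, hnθ⟩ := mem_s2Box_vec3N hθ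
  exact ndBoxE_parent_stiffnessSeqLeaf htθ (by linarith [hnθ.1]) (by linarith [hnθ.2])

/-- **Kinematic thermal stiffness word on `boxNdSrNiO2E_M59`** (every temperature): `ObsThermalStiffnessSeqCeilingAt … 4736879/10000000` at every point.
[cite: ParamekantiTrivediRanderia1998, eq. (3) and §IV] -/
theorem boxNdSrNiO2E_M59_thermalStiffness_kinematic :
    HoldsOn (fun p : OneBandCoord → ℝ =>
      ObsThermalStiffnessSeqCeilingAt (p .tpOverT) (p .UOverT) (p .filling) (4736879 / 10000000)) boxNdSrNiO2E_M59 := by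
  refine holdsOn_of_forall_s2Box (B := boxNdSrNiO2E_M59) (eU := ndSrNiO2E_M59_U) (eS := ndSrNiO2E_M59_tp) (eN := ndSrNiO2E_M59_n) rfl rfl rfl
    (W := fun θ => ObsThermalStiffnessSeqCeilingAt (θ 1) (θ 0) (θ 2) (4736879 / 10000000)) ?_
  rw [ndSrNiO2E_M59_s2Lo, ndSrNiO2E_M59_s2Hi]
  intro θ hθ
  obtain ⟨-, htθ, hnθ⟩ := mem_s2Box_vec3N hθ
  exact ndBoxE_parent_thermalStiffnessSeqLeaf htθ (by linarith [hnθ.1]) (by linarith [hnθ.2])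

/-- **KT reading on `boxNdSrNiO2E_M59`** (CONDITIONAL on `ThermalKTDictionaryAt` at the point, per NiO₂ plane): `T_c ≤ 0.3720337` (tree units `t = 1`).
[cite: HazraVermaRanderia2019, eqs. (2)-(3) and App. G] -/
theorem boxNdSrNiO2E_M59_Tc_le_kinematic_KT :
    HoldsOn (fun p : OneBandCoord → ℝ => ∀ (ρe : ℝ → ℝ) (Tc : ℝ),
      ThermalKTDictionaryAt (p .tpOverT) (p .UOverT) (p .filling) ρe Tc → Tc ≤ 0.3720337) boxNdSrNiO2E_M59 := by
  refine holdsOn_of_forall_s2Box (B := boxNdSrNiO2E_M59) (eU := ndSrNiO2E_M59_U) (eS := ndSrNiO2E_M59_tp) (eN := ndSrNiO2E_M59_n) rfl rfl rfl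
    (W := fun θ => ∀ (ρe : ℝ → ℝ) (Tc : ℝ), ThermalKTDictionaryAt (θ 1) (θ 0) (θ 2) ρe Tc → Tc ≤ 0.3720337) ?_
  rw [ndSrNiO2E_M59_s2Lo, ndSrNiO2E_M59_s2Hi]
  intro θ hθ ρe Tc hKT
  obtain ⟨-, htθ, hnθ⟩ := mem_s2Box_vec3N hθ
  exact Summit.Ventures.CertifiedManyBodySolver.Certificates.ThermalKTDictionaryAt.ndBoxE_parent_le_decimal htθ
    (by linarith [hnθ.1]) (by linarith [hnθ.2]) hKT

/-! ### `boxNdSrNiO2E_M60` — Nd₀.₇₅Sr₀.₂₅NiO₂ (VSET-v2 #60, object E: t′ ∈ [−0.46, −0.36], n ∈ [0.686, 0.786]) -/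

/-- **Kinematic ground-state stiffness word on `boxNdSrNiO2E_M60`** (node-free): `ρ_s ≤ 4414575/10000000` at every point of the box (hubbard-tc p1's
`ndBoxE_sr025_stiffnessSeqLeaf`, read at the column's exact top filling `393/500`). [cite: HazraVermaRanderia2019, eqs. (2)-(6)] -/
theorem boxNdSrNiO2E_M60_stiffness_kinematic :
    HoldsOn (fun p : OneBandCoord → ℝ =>
      ObsStiffnessSeqCeilingAt (p .tpOverT) (p .UOverT) (p .filling) (4414575 / 10000000)) boxNdSrNiO2E_M60 := by
  refine holdsOn_of_forall_s2Box (B := boxNdSrNiO2E_M60) (eU := ndSrNiO2E_M60_U) (eS := ndSrNiO2E_M60_tp) (eN := ndSrNiO2E_M60_n) rfl rfl rfl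
    (W := fun θ => ObsStiffnessSeqCeilingAt (θ 1) (θ 0) (θ 2) (4414575 / 10000000)) ?_
  rw [ndSrNiO2E_M60_s2Lo, ndSrNiO2E_M60_s2Hi]
  intro θ hθ
  obtain ⟨-, htθ, hnθ⟩ := mem_s2Box_vec3N hθ
  exact ndBoxE_sr025_stiffnessSeqLeaf htθ (by linarith [hnθ.1]) (by linarith [hnθ.2])

/-- **Kinematic thermal stiffness word on `boxNdSrNiO2E_M60`** (every temperature): `ObsThermalStiffnessSeqCeilingAt … 4414575/10000000` at every point.
[cite: ParamekantiTrivediRanderia1998, eq. (3) and §IV] -/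
theorem boxNdSrNiO2E_M60_thermalStiffness_kinematic :
    HoldsOn (fun p : OneBandCoord → ℝ =>
      ObsThermalStiffnessSeqCeilingAt (p .tpOverT) (p .UOverT) (p .filling) (4414575 / 10000000)) boxNdSrNiO2E_M60 := by
  refine holdsOn_of_forall_s2Box (B := boxNdSrNiO2E_M60) (eU := ndSrNiO2E_M60_U) (eS := ndSrNiO2E_M60_tp) (eN := ndSrNiO2E_M60_n) rfl rfl rfl
    (W := fun θ => ObsThermalStiffnessSeqCeilingAt (θ 1) (θ 0) (θ 2) (4414575 / 10000000)) ?_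
  rw [ndSrNiO2E_M60_s2Lo, ndSrNiO2E_M60_s2Hi]
  intro θ hθ
  obtain ⟨-, htθ, hnθ⟩ := mem_s2Box_vec3N hθ
  exact ndBoxE_sr025_thermalStiffnessSeqLeaf htθ (by linarith [hnθ.1]) (by linarith [hnθ.2])

/-- **KT reading on `boxNdSrNiO2E_M60`** (CONDITIONAL on `ThermalKTDictionaryAt` at the point, per NiO₂ plane): `T_c ≤ 0.3467200` (tree units `t = 1`).
[cite: HazraVermaRanderia2019, eqs. (2)-(3) and App. G] -/
theorem boxNdSrNiO2E_M60_Tc_le_kinematic_KT :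
    HoldsOn (fun p : OneBandCoord → ℝ => ∀ (ρe : ℝ → ℝ) (Tc : ℝ),
      ThermalKTDictionaryAt (p .tpOverT) (p .UOverT) (p .filling) ρe Tc → Tc ≤ 0.3467200) boxNdSrNiO2E_M60 := by
  refine holdsOn_of_forall_s2Box (B := boxNdSrNiO2E_M60) (eU := ndSrNiO2E_M60_U) (eS := ndSrNiO2E_M60_tp) (eN := ndSrNiO2E_M60_n) rfl rfl rfl
    (W := fun θ => ∀ (ρe : ℝ → ℝ) (Tc : ℝ), ThermalKTDictionaryAt (θ 1) (θ 0) (θ 2) ρe Tc → Tc ≤ 0.3467200) ?_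
  rw [ndSrNiO2E_M60_s2Lo, ndSrNiO2E_M60_s2Hi]
  intro θ hθ ρe Tc hKT
  obtain ⟨-, htθ, hnθ⟩ := mem_s2Box_vec3N hθ
  exact Summit.Ventures.CertifiedManyBodySolver.Certificates.ThermalKTDictionaryAt.ndBoxE_sr025_le_decimal htθ
    (by linarith [hnθ.1]) (by linarith [hnθ.2]) hKT

end Summit.Ventures.CertifiedManyBodySolver.Downfold

end
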